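import Literature.GroupTheory.FreeGroupProfiniteCompletionSlim
import Mathlib.GroupTheory.FreeGroup.NielsenSchreier
import Mathlib.LinearAlgebra.Matrix.SpecialLinearGroup
import Mathlib.GroupTheory.Index
import HarnessLib

/-!
# Finite-index subgroups of non-abelian free groups are non-abelian free; their profinite completions are slim

Topic `Literature/GroupTheory` — sequel of `FreeGroupProfiniteCompletionSlim.lean` (abc-iut cell,
campaign-L R1: slimness of `π̂₁` for EVERY finite cover of a space with free fundamental group, e.g.
every finite étale cover of `ℂ ∖ F`). Classical (Lyndon–Schupp, *Combinatorial Group Theory*, Ch. I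
Prop. 2.16–2.19: centralisers in free groups are cyclic; Prop. 3.8 Nielsen–Schreier):

* `FreeGroup.of_pow_mul_of_pow_ne` — **powers of distinct free generators do not commute**:
  `a^m b^m ≠ b^m a^m` in `FreeGroup ι` for `a ≠ b`, `m ≠ 0` (send `a ↦ (1 1; 0 1)`, `b ↦ (1 0; 1 1)`
  in `SL(2, ℤ)`: the `(0,0)` entries of the two products are `1 + m²` and `1`);
* `FreeGroup.exists_mul_ne_mul_of_finiteIndex` — **a finite-index subgroup of a free group on at
  least two letters is non-abelian** (`a^k, b^k` lie in its normal core, `k` the index of the core,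
  Mathlib `Subgroup.pow_index_mem`);
* `isSlimGroup_profiniteCompletion_subgroup_freeGroup` — hence, by Nielsen–Schreier (Mathlib
  `subgroupIsFreeOfIsFree`) and the tree's `isSlimGroup_profiniteCompletion_of_isFreeGroup`
  ([AbsAnab] Lemma 1.3.1), **its profinite completion is slim**;
* `isSlimGroup_profiniteCompletion_of_injective_finiteIndex` — the same for any group embedding
  with finite index into a group isomorphic to a free group on `≥ 2` letters (the shape of
  `p_* : π₁(Y) ↪ π₁(X)` for a finite connected cover).

Everything is proved; no definitions, no named facts.

## References

* R. C. Lyndon, P. E. Schupp, *Combinatorial Group Theory*, Springer 2001, Ch. I Props. 2.16–2.19,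
  Prop. 3.8. [LyndonSchupp2001]
* S. Mochizuki, *The absolute anabelian geometry of hyperbolic curves* (2004), Lemma 1.3.1.
  [MochizukiAbsAnab2004]
-/

noncomputable section

namespace Literature.GroupTheory

open Literature.AlgebraicGeometry.Frobenioids (IsSlimGroup)
open Literature.IUT.HodgeTheaters (profiniteCompletion)
open Function Matrix

universe u v w

/-! ### §1 Powers of distinct free generators do not commute -/

/-- Powers of an element of `SL(2, ℤ)` with matrix `(1 1; 0 1)`: `(1 m; 0 1)`.
[cite: LyndonSchupp2001, Ch. I Prop. 2.19] -/
theorem SpecialLinearGroup.coe_pow_of_coe_eq_upper {A : SpecialLinearGroup (Fin 2) ℤ}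
    (hA : (A : Matrix (Fin 2) (Fin 2) ℤ) = !![1, 1; 0, 1]) (m : ℕ) :
    ((A ^ m : SpecialLinearGroup (Fin 2) ℤ) : Matrix (Fin 2) (Fin 2) ℤ) = !![1, (m : ℤ); 0, 1] := by
  induction m with
  | zero =>
    rw [pow_zero, SpecialLinearGroup.coe_one, Nat.cast_zero]
    exact one_fin_two
  | succ k ih =>
    rw [pow_succ, SpecialLinearGroup.coe_mul, ih, hA, mul_fin_two, Nat.cast_succ]
    norm_num [add_comm]

/-- Powers of an element of `SL(2, ℤ)` with matrix `(1 0; 1 1)`: `(1 0; m 1)`.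
[cite: LyndonSchupp2001, Ch. I Prop. 2.19] -/
theorem SpecialLinearGroup.coe_pow_of_coe_eq_lower {B : SpecialLinearGroup (Fin 2) ℤ}
    (hB : (B : Matrix (Fin 2) (Fin 2) ℤ) = !![1, 0; 1, 1]) (m : ℕ) :
    ((B ^ m : SpecialLinearGroup (Fin 2) ℤ) : Matrix (Fin 2) (Fin 2) ℤ) = !![1, 0; (m : ℤ), 1] := by
  induction m with
  | zero =>
    rw [pow_zero, SpecialLinearGroup.coe_one, Nat.cast_zero]
    exact one_fin_two
  | succ k ih =>
    rw [pow_succ, SpecialLinearGroup.coe_mul, ih, hB, mul_fin_two, Nat.cast_succ]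
    norm_num

/-- **Powers of two distinct free generators do not commute**: in `FreeGroup ι`, for `a ≠ b` and
`m ≠ 0`, `(of a)^m (of b)^m ≠ (of b)^m (of a)^m` (map `a ↦ (1 1; 0 1)`, `b ↦ (1 0; 1 1)` into
`SL(2, ℤ)`; the `(0,0)` entries of the images are `1 + m²` and `1`). In particular the centraliser of
`(of a)^m` does not contain `(of b)^m` (Lyndon–Schupp I.2.19: commuting elements of a free group are
powers of a common element). [cite: LyndonSchupp2001, Ch. I Prop. 2.19] -/
theorem FreeGroup.of_pow_mul_of_pow_ne {ι : Type u} {a b : ι} (hab : a ≠ b) {m : ℕ} (hm : m ≠ 0) :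
    FreeGroup.of a ^ m * FreeGroup.of b ^ m ≠ FreeGroup.of b ^ m * FreeGroup.of a ^ m := by
  classical
  intro heq
  -- the two unipotents of `SL(2, ℤ)`
  let A : SpecialLinearGroup (Fin 2) ℤ := ⟨!![1, 1; 0, 1], by rw [det_fin_two_of]; ring⟩
  let B : SpecialLinearGroup (Fin 2) ℤ := ⟨!![1, 0; 1, 1], by rw [det_fin_two_of]; ring⟩
  have hA : (A : Matrix (Fin 2) (Fin 2) ℤ) = !![1, 1; 0, 1] := rfl
  have hB : (B : Matrix (Fin 2) (Fin 2) ℤ) = !![1, 0; 1, 1] := rfl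
  let s : ι → SpecialLinearGroup (Fin 2) ℤ := fun w =>
    if w = a then A else if w = b then B else 1
  have hsa : s a = A := by simp [s]
  have hsb : s b = B := by simp [s, Ne.symm hab]
  have h := congrArg (fun g => ((FreeGroup.lift s g : SpecialLinearGroup (Fin 2) ℤ) :
    Matrix (Fin 2) (Fin 2) ℤ) 0 0) heq
  simp only [map_mul, map_pow, FreeGroup.lift_apply_of, hsa, hsb, SpecialLinearGroup.coe_mul,
    SpecialLinearGroup.coe_pow_of_coe_eq_upper hA, SpecialLinearGroup.coe_pow_of_coe_eq_lower hB]
    at h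
  -- `(1 m; 0 1)(1 0; m 1)` has `(0,0)` entry `1 + m²`; `(1 0; m 1)(1 m; 0 1)` has `(0,0)` entry `1`
  rw [mul_fin_two, mul_fin_two] at h
  simp only [of_apply, cons_val', cons_val_zero, cons_val_fin_one, empty_val'] at h
  have hm' : (m : ℤ) ≠ 0 := by exact_mod_cast hm
  apply hm'
  nlinarith [h, sq_nonneg (m : ℤ)]

/-! ### §2 Finite-index subgroups of free groups are non-abelian -/

/-- **A finite-index subgroup of a free group on at least two letters is non-abelian**: with
`k = [F : N]` the (finite, positive) index of the normal core `N` of `H`, the powers `(of a)^k`,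
`(of b)^k` lie in `N ≤ H` (`Subgroup.pow_index_mem`) and do not commute.
[cite: LyndonSchupp2001, Ch. I Prop. 2.19] -/
theorem FreeGroup.exists_mul_ne_mul_of_finiteIndex {ι : Type u} (H : Subgroup (FreeGroup ι))
    [H.FiniteIndex] {a b : ι} (hab : a ≠ b) : ∃ x y : H, x * y ≠ y * x := by
  let N := H.normalCore
  haveI : N.FiniteIndex := Subgroup.finiteIndex_normalCore H
  have hk : N.index ≠ 0 := Subgroup.FiniteIndex.index_ne_zero
  have ha : FreeGroup.of a ^ N.index ∈ H := H.normalCore_le (N.pow_index_mem (FreeGroup.of a))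
  have hb : FreeGroup.of b ^ N.index ∈ H := H.normalCore_le (N.pow_index_mem (FreeGroup.of b))
  refine ⟨⟨_, ha⟩, ⟨_, hb⟩, fun h => FreeGroup.of_pow_mul_of_pow_ne hab hk ?_⟩
  exact congrArg Subtype.val h

/-- A finite-index subgroup of `FreeGroup (Fin n)`, `n ≥ 2`, is non-abelian.
[cite: LyndonSchupp2001, Ch. I Prop. 2.19] -/
theorem FreeGroup.exists_mul_ne_mul_of_finiteIndex_fin {n : ℕ} (hn : 2 ≤ n)
    (H : Subgroup (FreeGroup (Fin n))) [H.FiniteIndex] : ∃ x y : H, x * y ≠ y * x :=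
  FreeGroup.exists_mul_ne_mul_of_finiteIndex H (a := (⟨0, by omega⟩ : Fin n)) (b := ⟨1, by omega⟩)
    (by simp [Fin.ext_iff])

/-! ### §3 Slimness of the profinite completion -/

/-- **The profinite completion of a finite-index subgroup of a free group on at least two letters is
slim**: the subgroup is free (Nielsen–Schreier, Mathlib `subgroupIsFreeOfIsFree`) and non-abelian,
so [AbsAnab] Lemma 1.3.1 (the tree's `isSlimGroup_profiniteCompletion_of_isFreeGroup`) applies.
[cite: MochizukiAbsAnab2004, Lemma 1.3.1 p.15] [cite: LyndonSchupp2001, Ch. I Prop. 3.8] -/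
theorem isSlimGroup_profiniteCompletion_subgroup_freeGroup {ι : Type u} (H : Subgroup (FreeGroup ι))
    [H.FiniteIndex] {a b : ι} (hab : a ≠ b) : IsSlimGroup (profiniteCompletion H) :=
  isSlimGroup_profiniteCompletion_of_isFreeGroup (FreeGroup.exists_mul_ne_mul_of_finiteIndex H hab)

/-- **Slimness transports along a finite-index embedding into a free group**: if `f : G → K` is an
injective homomorphism whose image has finite index and `K ≅ FreeGroup ι` with two distinct letters,
then the profinite completion of `G` is slim (e.g. `G = π₁(Y, y)`, `K = π₁(X, x)`, `f = p_*` for a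
finite connected cover `p : Y → X` of a space with free `π₁`).
[cite: MochizukiAbsAnab2004, Lemma 1.3.1 p.15] [cite: LyndonSchupp2001, Ch. I Prop. 3.8] -/
theorem isSlimGroup_profiniteCompletion_of_injective_finiteIndex {G : Type v} [Group G]
    {K : Type w} [Group K] {ι : Type u} (e : K ≃* FreeGroup ι) (f : G →* K) (hf : Injective f)
    [hfi : f.range.FiniteIndex] {a b : ι} (hab : a ≠ b) : IsSlimGroup (profiniteCompletion G) := by
  -- the image of `G` in the free group: a finite-index subgroup
  let H : Subgroup (FreeGroup ι) := f.range.map (e : K →* FreeGroup ι)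
  haveI : H.FiniteIndex := by
    constructor
    change (Subgroup.map (e : K →* FreeGroup ι) f.range).index ≠ 0
    rw [Subgroup.index_map_equiv]
    exact hfi.index_ne_zero
  -- `G ≅ f(G) ≅ H`
  let eG : G ≃* H := (MonoidHom.ofInjective hf).trans (e.subgroupMap f.range)
  haveI : IsFreeGroup G := IsFreeGroup.ofMulEquiv eG.symm
  exact isSlimGroup_profiniteCompletion_of_isFreeGroup
    (exists_mul_ne_mul_of_mulEquiv eG (FreeGroup.exists_mul_ne_mul_of_finiteIndex H hab))

/-- The `Fin n` form: an injective homomorphism with finite-index image into a group isomorphic to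
`FreeGroup (Fin n)`, `n ≥ 2`, has slim profinite completion of its source.
[cite: MochizukiAbsAnab2004, Lemma 1.3.1 p.15] -/
theorem isSlimGroup_profiniteCompletion_of_injective_finiteIndex_fin {G : Type v} [Group G]
    {K : Type w} [Group K] {n : ℕ} (e : K ≃* FreeGroup (Fin n)) (hn : 2 ≤ n) (f : G →* K)
    (hf : Injective f) [f.range.FiniteIndex] : IsSlimGroup (profiniteCompletion G) :=
  isSlimGroup_profiniteCompletion_of_injective_finiteIndex e f hf
    (a := (⟨0, by omega⟩ : Fin n)) (b := ⟨1, by omega⟩) (by simp [Fin.ext_iff])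

end Literature.GroupTheory
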